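import Summits.BirchSwinnertonDyer.BirchSwinnertonDyer.Theorems.Rank1ResidualJetConjActDualSelmer
import Summits.BirchSwinnertonDyer.BirchSwinnertonDyer.Theorems.Rank1ResidualJetGlobalDuality
import Summits.BirchSwinnertonDyer.BirchSwinnertonDyer.Theorems.Rank1ResidualJetGlobalDualityAnnihilator
import HarnessLib

/-!
# T1 JET (cell `bsd-jet`), road K, stub S1: Poitou–Tate counting for Selmer structures on `E[n]`
# SIGN BY SIGN under complex conjugation — the `−ε` ∕ `+ε` counting identities of Jetchev 2008 Thm. 5.1

HONEST FRAMING (programme file `BSD-LIT2PART-PROGRAMME-v1.md` §HONESTY, verbatim): «no tranche here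
proves BSD; ARM L moves the LITERAL column of an r ≤ 1 census into the kernel-proved-modulo-named-print
column; ARM P changes what «named print» is worth.» THEOREMS ONLY (seat `bsd-jet-pv-1`, session g4;
`--supports stmt-BirchSwinnertonDyer-14418`, helper): no definition, no named fact, no `sorry`.
Nothing is booked; 0 classes move.

## What

This file closes stub S1 of the (J∥) kernel line (sheet `HOME/sheets/PV2-J6-KERNEL.md` §2) modulo ONE
named property of the local invariant maps: for `E = W/ℚ`, a number field `K`, `σ ∈ Aut(K/ℚ)` with
`σ² = 1` (complex conjugation of an imaginary quadratic `K`), `N` odd, a family `inv` of local invariant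
maps with local Tate duality, the Poitou–Tate vanishing, Howard's complement property AND the
compatibility `inv_{σv} ∘ σ_* = inv_v` (`LocalInvariants.IsConjCompatible`, Serre in Cassels–Fröhlich
VI §1.1), `σ`-stable Selmer structures `𝓕 ≤ 𝓖` on `E[n]` unramified outside `S` (finite places `T`,
`σ`-stable), the `±`-eigenspace counting identity holds:

`[𝓗_𝓖^± : 𝓗_𝓕^±] · [𝓗_{𝓕^*}^± : 𝓗_{𝓖^*}^±] = [(Π_{v∈T} 𝓖_v)^± + Π𝓕_v : Π𝓕_v]`

(`relIndex_selmerGroup_mul_relIndex_dualSelmerGroup_minus ∕ _plus`), where `𝓗_𝓖^± = H¹_𝓖(K,E[n]) ∩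
H¹(K, E[n])^±` are Jetchev's `±`-Selmer modules (§6.2) for `conjAct W σ n`, `𝓗_{𝓖^*}^±` their dual
companions for `conjActDual`, and `(Π 𝓖_v)^±` the `±`-part for the involution `τ_X` of
`Π_{v∈T} H¹(K_v, E[n])` induced by `σ_*` and `v ↦ σ v`. Ingredients, all kernel theorems of the tree:
the permutation layer (`…PairingCountingPermutation`, p486423), `conjActPlace` ∕ `conjActPlaceDual` and
their round trips, equivariance and adjointness (`SelmerGaloisActionPlaces`, `SemilinearTateDualPlaces`),
the annihilator identity (`…GlobalDualityAnnihilator`, p482172), and the dual-side stabilities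
(`Rank1ResidualJetConjActDualSelmer`). One `set_option maxHeartbeats 400000` (2×) for the assembly
step (a single application of the permutation layer with ~45 dependent arguments).

References (locators only; no cited FACT is declared): [cite: Jetchev2008, §5 Thm. 5.1, Lemma 5.2 (iii)
(p. 822), §6.2 and proof of Thm. 6.3 (p. 823)] [cite: Howard2004HeegnerKolyvagin, Thm. 2.1.11]
[cite: MilneADT2006, Ch. I §0 (0.19), Cor. 2.3, Thm. 4.10(b)] [cite: CasselsFrohlichANT1967, Ch. VI §1.1,
Ch. VII §1.1]. Design: no definitions; universe `u` for `K`. Axioms: `propext`, `Classical.choice`,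
`Quot.sound`.
-/

set_option autoImplicit false

noncomputable section

open scoped Classical
open Function NumberField IsDedekindDomain WeierstrassCurve Field
open Literature.NumberTheory.EllipticCurves Literature.NumberTheory.GaloisRepresentations
open Literature.NumberTheory.GaloisCohomology
open Literature.NumberTheory.GaloisRepresentations.DiscreteGaloisModule (localTatePairingZMod
  tateDual SelmerStructure)

universe u

namespace Summit.BirchSwinnertonDyer.Rank1Residual.JET.GlobalDuality

/-! ### The signed counting identities for Selmer structures on `E[n]` -/

section Signed

variable {K : Type u} [Field K] [NumberField K] (W : WeierstrassCurve ℚ) (σ : K ≃ₐ[ℚ] K) (n : ℤ)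
  {N : ℕ} [NeZero N] [Finite (geomTorsion (W.baseChange K) n)]

set_option maxHeartbeats 400000 in
/-- **Poitou–Tate counting for Selmer structures on `E[n]`, on the `−1`-EIGENSPACES of complex
conjugation (Jetchev 2008, Thm. 5.1 / Lemma 5.2 (iii) on the `−ε` side; the input `horth_q`, `horth_ℓ`
of the cell's abstract Thm. 6.3).** Setting: `E = W/ℚ`; `K` a number field and `σ ∈ Aut(K/ℚ)` with
`σ² = 1`; `N` odd killing `E[n]` (`N = n = p^m`); `inv` a family of local invariant maps with local
Tate duality (`IsPerfect`), the Poitou–Tate vanishing (`SumLocalTermEqZero`), Howard's complement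
property (`SelmerComplement`) — conjuncts of the tree's `poitouTate_selmerStructure_duality` — and
compatible with conjugation (`IsConjCompatible`: `inv_{σv} ∘ σ_* = inv_v`, the one further published
property of the invariant maps this identity needs); `S ⊇ {∞, v ∣ N, Ram}` with `σ`-stable set `T` of
finite places; Selmer structures `𝓕 ≤ 𝓖` on `E[n]` unramified outside `S`, carried into themselves
by `σ_*` (`conjActPlace`) at the finite places, everything at the infinite places (as are their duals:
`H¹(ℂ, ·) = 0`); and the X-∕Y-side transport data `(π, eX, τ_X)`, `(eY, τ_Y)` of
`exists_piTransport_conjActPlace[Dual]` (passed explicitly so that the local index on the right is a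
named quantity). CONCLUSION, with `H⁻ = ker(conjAct + 1)`, `(H^D)⁻ = ker(conjActDual + 1)`,
`X⁻ = ker(τ_X + 1)`:

`[H¹_𝓖 ∩ H⁻ : H¹_𝓕 ∩ H⁻] · [H¹_{𝓕^*} ∩ (H^D)⁻ : H¹_{𝓖^*} ∩ (H^D)⁻] = (Π_{v∈T} 𝓕_v).relIndex ((Π_{v∈T} 𝓖_v) ∩ X⁻)`.

PROOF: the permutation layer (`relIndex_mul_relIndex_eq_of_iInf_ker_sup_minus_of_piTransport`) fed
with the annihilator identity (`iInf_ker_map_sup_pi_eq`), the perfectness of `∑_v ⟨,⟩_v`, the round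
trips, `loc`-equivariances and adjointness (`localTatePairingZMod_conjActPlace`) of `σ_*`, the
`σ_*`-stability of the four Selmer groups; then `loc_T(S) ∩ X⁻ = loc_T(S ∩ H⁻)` (`map_inf_ker_add_id_eq`)
and `loc_T⁻¹(Π𝓕_v) ∩ H¹_𝓖 = H¹_𝓕`. [cite: Jetchev2008, Thm. 5.1 and Lemma 5.2 (iii) (p. 822), proof
of Thm. 6.3 (p. 823)] [cite: Howard2004HeegnerKolyvagin, Thm. 2.1.11] [cite: MilneADT2006, Ch. I §0 (0.19)] -/
theorem relIndex_selmerGroup_mul_relIndex_dualSelmerGroup_minus (hσ : σ * σ = 1) (hN : Odd N)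
    (hM : ∀ P : geomTorsion (W.baseChange K) n, N • P = 0)
    (inv : LocalInvariants K N) (hperf : inv.IsPerfect) (hvan : inv.SumLocalTermEqZero)
    (hSC : inv.SelmerComplement) (hinv : inv.IsConjCompatible σ)
    (S : Finset (Place K)) (T : Finset (HeightOneSpectrum (𝓞 K)))
    (hT : ∀ v, (Sum.inr v : Place K) ∈ S ↔ v ∈ T)
    (hS : ∀ v : HeightOneSpectrum (𝓞 K), (Sum.inr v : Place K) ∉ S →
      ((N : ℕ) : 𝓞 K) ∉ v.asIdeal ∧ GaloisRep.IsUnramifiedAt v ((W.baseChange K).torsionGaloisModule n))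
    {𝓕 𝓖 : SelmerStructure ((W.baseChange K).torsionGaloisModule n)} (hle : 𝓕 ≤ 𝓖)
    (h𝓕 : 𝓕.IsUnramifiedOutside S) (h𝓖 : 𝓖.IsUnramifiedOutside S)
    (h𝓕σ : ∀ (v w : HeightOneSpectrum (𝓞 K)) (h : σ • v = w)
      (x : galoisCohomology (((W.baseChange K).torsionGaloisModule n).toLocal (Sum.inr v : Place K)) 1),
      x ∈ 𝓕 (Sum.inr v) → conjActPlace W σ n h x ∈ 𝓕 (Sum.inr w))
    (h𝓖σ : ∀ (v w : HeightOneSpectrum (𝓞 K)) (h : σ • v = w)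
      (x : galoisCohomology (((W.baseChange K).torsionGaloisModule n).toLocal (Sum.inr v : Place K)) 1),
      x ∈ 𝓖 (Sum.inr v) → conjActPlace W σ n h x ∈ 𝓖 (Sum.inr w))
    (h𝓕inf : ∀ w : InfinitePlace K, 𝓕 (Sum.inl w) = ⊤)
    (h𝓖inf : ∀ w : InfinitePlace K, 𝓖 (Sum.inl w) = ⊤)
    (h𝓕dinf : ∀ w : InfinitePlace K,
      inv.dualSelmerStructure ((W.baseChange K).torsionGaloisModule n) 𝓕 (Sum.inl w) = ⊤)
    -- the X-side and Y-side transport data (outputs of `exists_piTransport_conjActPlace[Dual]`)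
    (π : T → T) (hπ : Function.Involutive π)
    (hπσ : ∀ i : T, ((π i : T) : HeightOneSpectrum (𝓞 K)) = σ • (i : HeightOneSpectrum (𝓞 K)))
    (eX : ∀ i j : T,
      galoisCohomology (((W.baseChange K).torsionGaloisModule n).toLocal
        (Sum.inr (i : HeightOneSpectrum (𝓞 K)) : Place K)) 1 →+
      galoisCohomology (((W.baseChange K).torsionGaloisModule n).toLocal
        (Sum.inr (j : HeightOneSpectrum (𝓞 K)) : Place K)) 1)
    (heX : ∀ (i j : T) (h : σ • (i : HeightOneSpectrum (𝓞 K)) = j), eX i j = conjActPlace W σ n h)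
    (τX : (∀ i : T, galoisCohomology (((W.baseChange K).torsionGaloisModule n).toLocal
        (Sum.inr (i : HeightOneSpectrum (𝓞 K)) : Place K)) 1) →+
      ∀ i : T, galoisCohomology (((W.baseChange K).torsionGaloisModule n).toLocal
        (Sum.inr (i : HeightOneSpectrum (𝓞 K)) : Place K)) 1)
    (hτX : ∀ x j, τX x j = eX (π j) j (x (π j)))
    (eY : ∀ i j : T,
      galoisCohomology ((((W.baseChange K).torsionGaloisModule n).tateDual N).toLocal
        (Sum.inr (i : HeightOneSpectrum (𝓞 K)) : Place K)) 1 →+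
      galoisCohomology ((((W.baseChange K).torsionGaloisModule n).tateDual N).toLocal
        (Sum.inr (j : HeightOneSpectrum (𝓞 K)) : Place K)) 1)
    (heY : ∀ (i j : T) (h : σ • (i : HeightOneSpectrum (𝓞 K)) = j),
      eY i j = conjActPlaceDual W σ n N h)
    (τY : (∀ i : T, galoisCohomology ((((W.baseChange K).torsionGaloisModule n).tateDual N).toLocal
        (Sum.inr (i : HeightOneSpectrum (𝓞 K)) : Place K)) 1) →+
      ∀ i : T, galoisCohomology ((((W.baseChange K).torsionGaloisModule n).tateDual N).toLocal
        (Sum.inr (i : HeightOneSpectrum (𝓞 K)) : Place K)) 1)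
    (hτY : ∀ y j, τY y j = eY (π j) j (y (π j))) :
    (𝓕.selmerGroup ⊓ (conjAct W σ n + AddMonoidHom.id _).ker).relIndex
        (𝓖.selmerGroup ⊓ (conjAct W σ n + AddMonoidHom.id _).ker) *
      ((inv.dualSelmerStructure ((W.baseChange K).torsionGaloisModule n) 𝓖).selmerGroup ⊓
          (conjActDual W σ n N + AddMonoidHom.id _).ker).relIndex
        ((inv.dualSelmerStructure ((W.baseChange K).torsionGaloisModule n) 𝓕).selmerGroup ⊓
          (conjActDual W σ n N + AddMonoidHom.id _).ker) =
      (AddSubgroup.pi Set.univ fun t : T => 𝓕 (Sum.inr (t : HeightOneSpectrum (𝓞 K)))).relIndex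
        (AddSubgroup.pi Set.univ (fun t : T => 𝓖 (Sum.inr (t : HeightOneSpectrum (𝓞 K)))) ⊓
          (τX + AddMonoidHom.id _).ker) := by
  classical
  -- finiteness of the local cohomology groups at the finite places of `T`
  haveI hfinX : ∀ t : T,
      Finite (galoisCohomology (((W.baseChange K).torsionGaloisModule n).toLocal (Sum.inr (t : HeightOneSpectrum (𝓞 K)))) 1) :=
    fun t => finite_galoisCohomology_one_toLocal ((W.baseChange K).torsionGaloisModule n) t
  haveI hfinY : ∀ t : T,
      Finite (galoisCohomology ((((W.baseChange K).torsionGaloisModule n).tateDual N).toLocal (Sum.inr (t : HeightOneSpectrum (𝓞 K)))) 1) :=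
    fun t => finite_galoisCohomology_one_tateDual_toLocal ((W.baseChange K).torsionGaloisModule n) N t
  -- the local Tate pairings and their sum
  set b : ∀ t : T, galoisCohomology (((W.baseChange K).torsionGaloisModule n).toLocal (Sum.inr (t : HeightOneSpectrum (𝓞 K)))) 1 →+
      galoisCohomology ((((W.baseChange K).torsionGaloisModule n).tateDual N).toLocal (Sum.inr (t : HeightOneSpectrum (𝓞 K)))) 1 →+
        ZMod N :=
    fun t => localTatePairingZMod ((W.baseChange K).torsionGaloisModule n) N (Sum.inr (t : HeightOneSpectrum (𝓞 K)))
      (inv (Sum.inr (t : HeightOneSpectrum (𝓞 K)))) with hb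
  set bS : (∀ t : T, galoisCohomology (((W.baseChange K).torsionGaloisModule n).toLocal (Sum.inr (t : HeightOneSpectrum (𝓞 K)))) 1) →+
      (∀ t : T, galoisCohomology ((((W.baseChange K).torsionGaloisModule n).tateDual N).toLocal (Sum.inr (t : HeightOneSpectrum (𝓞 K)))) 1)
        →+ ZMod N :=
    ∑ t : T, ((b t).comp (Pi.evalAddMonoidHom
        (fun t : T => galoisCohomology (((W.baseChange K).torsionGaloisModule n).toLocal (Sum.inr (t : HeightOneSpectrum (𝓞 K)))) 1) t)).compl₂
      (Pi.evalAddMonoidHom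
        (fun t : T => galoisCohomology ((((W.baseChange K).torsionGaloisModule n).tateDual N).toLocal
          (Sum.inr (t : HeightOneSpectrum (𝓞 K)))) 1) t) with hbS_def
  have hbS : ∀ x y, bS x y = ∑ t, b t (x t) (y t) := fun x y => by
    simp only [hbS_def, AddMonoidHom.finsetSum_apply, AddMonoidHom.compl₂_apply,
      AddMonoidHom.coe_comp, comp_apply, Pi.evalAddMonoidHom_apply]
  -- torsion and perfectness
  have hHn : ∀ c : galoisCohomology ((W.baseChange K).torsionGaloisModule n) 1, N • c = 0 :=
    fun c => galoisCohomology.nsmul_eq_zero_of_forall _ hM c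
  have hXn : ∀ x : ∀ t : T, galoisCohomology (((W.baseChange K).torsionGaloisModule n).toLocal (Sum.inr (t : HeightOneSpectrum (𝓞 K)))) 1,
      N • x = 0 :=
    fun x => funext fun t => galoisCohomology.nsmul_eq_zero_of_forall _ hM (x t)
  have hYn : ∀ y : ∀ t : T,
      galoisCohomology ((((W.baseChange K).torsionGaloisModule n).tateDual N).toLocal (Sum.inr (t : HeightOneSpectrum (𝓞 K)))) 1,
      N • y = 0 :=
    fun y => funext fun t => galoisCohomology.nsmul_eq_zero_of_forall _
      (fun f => DiscreteGaloisModule.TateDual.nsmul_eq_zero f) (y t)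
  have hl : Injective bS :=
    sum_pairing_injective b bS hbS fun t => ((hperf t).2 ((W.baseChange K).torsionGaloisModule n) hM).1.injective
  have hr : Injective bS.flip :=
    sum_pairing_flip_injective b bS hbS fun t => ((hperf t).2 ((W.baseChange K).torsionGaloisModule n) hM).2.injective
  -- localisation tuples
  set locT := AddMonoidHom.pi fun t : T =>
    galoisCohomology.localization ((W.baseChange K).torsionGaloisModule n) (Sum.inr (t : HeightOneSpectrum (𝓞 K))) 1 with hlocT
  set locT' := AddMonoidHom.pi fun t : T =>
    galoisCohomology.localization (((W.baseChange K).torsionGaloisModule n).tateDual N) (Sum.inr (t : HeightOneSpectrum (𝓞 K))) 1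
    with hlocT'
  have hlocT_apply : ∀ x (t : T), locT x t =
      galoisCohomology.localization ((W.baseChange K).torsionGaloisModule n) (Sum.inr (t : HeightOneSpectrum (𝓞 K))) 1 x :=
    fun x t => by rw [hlocT, AddMonoidHom.pi_apply]
  have hlocT'_apply : ∀ y (t : T), locT' y t =
      galoisCohomology.localization (((W.baseChange K).torsionGaloisModule n).tateDual N) (Sum.inr (t : HeightOneSpectrum (𝓞 K))) 1 y :=
    fun y t => by rw [hlocT', AddMonoidHom.pi_apply]
  -- annihilator of `Π 𝓖_v`, and the annihilator identity `(L + F)^⊥ = L' + G^⊥`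
  have hannG : (⨅ s ∈ AddSubgroup.pi Set.univ
      (fun t : T => 𝓖 (Sum.inr (t : HeightOneSpectrum (𝓞 K)))), (bS s).ker : AddSubgroup _) =
      AddSubgroup.pi Set.univ fun t : T => inv.dualSelmerStructure
        ((W.baseChange K).torsionGaloisModule n) 𝓖 (Sum.inr (t : HeightOneSpectrum (𝓞 K))) :=
    iInf_ker_pi_eq_pi_dual inv T bS hbS 𝓖
  have hinf : ∀ w : InfinitePlace K, 𝓕 (Sum.inl w) = 𝓖 (Sum.inl w) := fun w => by
    rw [h𝓕inf, h𝓖inf]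
  have hann := iInf_ker_map_sup_pi_eq inv T bS hbS hvan hSC hM S hT hS hle h𝓕 h𝓖 hinf
  rw [← hannG] at hann
  -- the `τ`-hypotheses, place by place
  have hroundX : ∀ (j : T) (y : galoisCohomology (((W.baseChange K).torsionGaloisModule n).toLocal
      (Sum.inr (j : HeightOneSpectrum (𝓞 K)))) 1), eX (π j) j (eX j (π j) y) = y := by
    intro j y
    have h1 : σ • (j : HeightOneSpectrum (𝓞 K)) = (π j : T) := (hπσ j).symm
    have h2 : σ • ((π j : T) : HeightOneSpectrum (𝓞 K)) = j := by
      rw [hπσ, ← mul_smul, hσ, one_smul]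
    rw [heX j (π j) h1, heX (π j) j h2]
    exact conjActPlace_conjActPlace W σ n hσ h1 h2 y
  have hroundY : ∀ (j : T) (y : galoisCohomology ((((W.baseChange K).torsionGaloisModule n).tateDual N).toLocal
      (Sum.inr (j : HeightOneSpectrum (𝓞 K)))) 1), eY (π j) j (eY j (π j) y) = y := by
    intro j y
    have h1 : σ • (j : HeightOneSpectrum (𝓞 K)) = (π j : T) := (hπσ j).symm
    have h2 : σ • ((π j : T) : HeightOneSpectrum (𝓞 K)) = j := by
      rw [hπσ, ← mul_smul, hσ, one_smul]
    rw [heY j (π j) h1, heY (π j) j h2]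
    exact conjActPlaceDual_conjActPlaceDual W σ n N hσ h1 h2 y
  have hπj : ∀ j : T, σ • ((π j : T) : HeightOneSpectrum (𝓞 K)) = j := fun j => by
    rw [hπσ, ← mul_smul, hσ, one_smul]
  have hbτ : ∀ (j : T) (x : galoisCohomology (((W.baseChange K).torsionGaloisModule n).toLocal
      (Sum.inr ((π j : T) : HeightOneSpectrum (𝓞 K)))) 1)
      (y : galoisCohomology ((((W.baseChange K).torsionGaloisModule n).tateDual N).toLocal
        (Sum.inr ((π j : T) : HeightOneSpectrum (𝓞 K)))) 1),
      b j (eX (π j) j x) (eY (π j) j y) = b (π j) x y := by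
    intro j x y
    rw [heX (π j) j (hπj j), heY (π j) j (hπj j)]
    exact localTatePairingZMod_conjActPlace W σ n N inv hinv (hπj j) x y
  have sF : ∀ (j : T) (y : galoisCohomology (((W.baseChange K).torsionGaloisModule n).toLocal
      (Sum.inr ((π j : T) : HeightOneSpectrum (𝓞 K)))) 1),
      y ∈ 𝓕 (Sum.inr ((π j : T) : HeightOneSpectrum (𝓞 K))) →
        eX (π j) j y ∈ 𝓕 (Sum.inr (j : HeightOneSpectrum (𝓞 K))) := by
    intro j y hy
    rw [heX (π j) j (hπj j)]
    exact h𝓕σ _ _ (hπj j) y hy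
  have sG : ∀ (j : T) (y : galoisCohomology (((W.baseChange K).torsionGaloisModule n).toLocal
      (Sum.inr ((π j : T) : HeightOneSpectrum (𝓞 K)))) 1),
      y ∈ 𝓖 (Sum.inr ((π j : T) : HeightOneSpectrum (𝓞 K))) →
        eX (π j) j y ∈ 𝓖 (Sum.inr (j : HeightOneSpectrum (𝓞 K))) := by
    intro j y hy
    rw [heX (π j) j (hπj j)]
    exact h𝓖σ _ _ (hπj j) y hy
  have hequiv : ∀ (j : T) (s : galoisCohomology ((W.baseChange K).torsionGaloisModule n) 1),
      galoisCohomology.localization ((W.baseChange K).torsionGaloisModule n) (Sum.inr (j : HeightOneSpectrum (𝓞 K))) 1 (conjAct W σ n s) =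
        eX (π j) j (galoisCohomology.localization ((W.baseChange K).torsionGaloisModule n)
          (Sum.inr ((π j : T) : HeightOneSpectrum (𝓞 K))) 1 s) := by
    intro j s
    rw [heX (π j) j (hπj j)]
    exact (conjActPlace_localization W σ n (hπj j) s).symm
  have hequiv' : ∀ (j : T) (y : galoisCohomology (((W.baseChange K).torsionGaloisModule n).tateDual N) 1),
      galoisCohomology.localization (((W.baseChange K).torsionGaloisModule n).tateDual N) (Sum.inr (j : HeightOneSpectrum (𝓞 K))) 1
          (conjActDual W σ n N y) =
        eY (π j) j (galoisCohomology.localization (((W.baseChange K).torsionGaloisModule n).tateDual N)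
          (Sum.inr ((π j : T) : HeightOneSpectrum (𝓞 K))) 1 y) := by
    intro j y
    rw [heY (π j) j (hπj j)]
    exact (conjActPlaceDual_localization W σ n N (hπj j) y).symm
  -- stability of the global Selmer groups
  have hSG : ∀ s ∈ 𝓖.selmerGroup, conjAct W σ n s ∈ 𝓖.selmerGroup :=
    fun s hs => conjAct_mem_selmerGroup_of_transport W σ n 𝓖 h𝓖σ h𝓖inf hs
  have hS'F : ∀ y ∈ (inv.dualSelmerStructure ((W.baseChange K).torsionGaloisModule n) 𝓕).selmerGroup,
      conjActDual W σ n N y ∈ (inv.dualSelmerStructure ((W.baseChange K).torsionGaloisModule n) 𝓕).selmerGroup :=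
    fun y hy => conjActDual_mem_selmerGroup_of_transport W σ n N _
      (fun v w h y' hy' => conjActPlaceDual_mem_dualLocalCondition W σ n N hσ inv hinv 𝓕 h𝓕σ h hy')
      h𝓕dinf hy
  -- the signed counting identity on product groups
  have hcount := relIndex_mul_relIndex_eq_of_iInf_ker_sup_minus_of_piTransport hN b bS hbS hXn hYn
    hl hr π hπ eX eY hroundX hroundY hbτ τX τY hτX hτY
    (fun t : T => 𝓕 (Sum.inr (t : HeightOneSpectrum (𝓞 K))))
    (fun t : T => 𝓖 (Sum.inr (t : HeightOneSpectrum (𝓞 K)))) (fun t => hle _) sF sG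
    (conjAct W σ n) (conjActDual W σ n N)
    (fun t : T => galoisCohomology.localization ((W.baseChange K).torsionGaloisModule n) (Sum.inr (t : HeightOneSpectrum (𝓞 K))) 1) locT
    hlocT_apply hequiv
    (fun t : T => galoisCohomology.localization (((W.baseChange K).torsionGaloisModule n).tateDual N)
      (Sum.inr (t : HeightOneSpectrum (𝓞 K))) 1) locT' hlocT'_apply hequiv'
    𝓖.selmerGroup hSG (inv.dualSelmerStructure ((W.baseChange K).torsionGaloisModule n) 𝓕).selmerGroup hS'F hann
  rw [hannG] at hcount
  -- `loc_T(S) ∩ X⁻ = loc_T(S ∩ H⁻)` on both sides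
  have hcX : ∀ s, conjAct W σ n (conjAct W σ n s) = s := conjAct_conjAct_of_mul_self W hσ n
  have hcY : ∀ y : galoisCohomology (((W.baseChange K).torsionGaloisModule n).tateDual N) 1,
      conjActDual W σ n N (conjActDual W σ n N y) = y := conjActDual_conjActDual W σ n N hσ
  have hH'n : ∀ y : galoisCohomology (((W.baseChange K).torsionGaloisModule n).tateDual N) 1, N • y = 0 :=
    fun y => galoisCohomology.nsmul_eq_zero_of_forall _
      (fun f => DiscreteGaloisModule.TateDual.nsmul_eq_zero f) y
  rw [map_inf_ker_add_id_eq π eX τX hτX (conjAct W σ n)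
      (fun t : T => galoisCohomology.localization ((W.baseChange K).torsionGaloisModule n) (Sum.inr (t : HeightOneSpectrum (𝓞 K))) 1) locT
      hlocT_apply hequiv hN hHn hXn hcX 𝓖.selmerGroup hSG,
    map_inf_ker_add_id_eq π eY τY hτY (conjActDual W σ n N)
      (fun t : T => galoisCohomology.localization (((W.baseChange K).torsionGaloisModule n).tateDual N)
        (Sum.inr (t : HeightOneSpectrum (𝓞 K))) 1) locT' hlocT'_apply hequiv' hN hH'n hYn hcY
      (inv.dualSelmerStructure ((W.baseChange K).torsionGaloisModule n) 𝓕).selmerGroup hS'F] at hcount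
  -- the structures agree off `T`
  have hoff : ∀ v : Place K, (∀ t ∈ T, v ≠ Sum.inr t) → 𝓕 v = 𝓖 v := by
    intro v hv
    cases v with
    | inl w => exact hinf w
    | inr v =>
      have hvS : (Sum.inr v : Place K) ∉ S := fun h => hv v ((hT v).mp h) rfl
      exact SelmerStructure.IsUnramifiedOutside.apply_eq_of_not_mem h𝓕 h𝓖 hvS
  -- `loc_T⁻¹(Π𝓕_v) ∩ H¹_𝓖 = H¹_𝓕`
  have hkerF : (AddSubgroup.pi Set.univ
      (fun t : T => 𝓕 (Sum.inr (t : HeightOneSpectrum (𝓞 K))))).comap locT ⊓ 𝓖.selmerGroup =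
      𝓕.selmerGroup := by
    apply le_antisymm
    · rintro x ⟨hxF, hxG⟩
      refine mem_selmerGroup_of_forall_mem 𝓕 𝓖 T (fun v hv => le_of_eq (hoff v hv).symm) hxG
        fun t ht => ?_
      have := (AddSubgroup.mem_pi _).mp (AddSubgroup.mem_comap.mp hxF) ⟨t, ht⟩ (Set.mem_univ _)
      rwa [hlocT_apply] at this
    · intro x hx
      refine ⟨AddSubgroup.mem_comap.mpr ((AddSubgroup.mem_pi _).mpr fun t _ => ?_),
        selmerGroup_mono hle hx⟩
      rw [hlocT_apply]
      exact (SelmerStructure.mem_selmerGroup_iff _ _).mp hx _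
  have hkerG : (AddSubgroup.pi Set.univ fun t : T => inv.dualSelmerStructure
        ((W.baseChange K).torsionGaloisModule n) 𝓖 (Sum.inr (t : HeightOneSpectrum (𝓞 K)))).comap
        locT' ⊓ (inv.dualSelmerStructure ((W.baseChange K).torsionGaloisModule n) 𝓕).selmerGroup =
      (inv.dualSelmerStructure ((W.baseChange K).torsionGaloisModule n) 𝓖).selmerGroup := by
    apply le_antisymm
    · rintro y ⟨hyG, hyF⟩
      refine mem_selmerGroup_of_forall_mem (inv.dualSelmerStructure ((W.baseChange K).torsionGaloisModule n) 𝓖)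
        (inv.dualSelmerStructure ((W.baseChange K).torsionGaloisModule n) 𝓕) T (fun v hv => ?_) hyF fun t ht => ?_
      · rw [LocalInvariants.dualSelmerStructure_apply, LocalInvariants.dualSelmerStructure_apply]
        exact inv.dualLocalCondition_anti ((W.baseChange K).torsionGaloisModule n) v (le_of_eq (hoff v hv).symm)
      · have := (AddSubgroup.mem_pi _).mp (AddSubgroup.mem_comap.mp hyG) ⟨t, ht⟩ (Set.mem_univ _)
        rwa [hlocT'_apply] at this
    · intro y hy
      refine ⟨AddSubgroup.mem_comap.mpr ((AddSubgroup.mem_pi _).mpr fun t _ => ?_),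
        inv.selmerGroup_dualSelmerStructure_anti ((W.baseChange K).torsionGaloisModule n) hle hy⟩
      rw [hlocT'_apply]
      exact (SelmerStructure.mem_selmerGroup_iff _ _).mp hy _
  -- convert the two global factors
  have ha : (AddSubgroup.pi Set.univ
        (fun t : T => 𝓕 (Sum.inr (t : HeightOneSpectrum (𝓞 K))))).relIndex
        ((𝓖.selmerGroup ⊓ (conjAct W σ n + AddMonoidHom.id _).ker).map locT) =
      (𝓕.selmerGroup ⊓ (conjAct W σ n + AddMonoidHom.id _).ker).relIndex
        (𝓖.selmerGroup ⊓ (conjAct W σ n + AddMonoidHom.id _).ker) := by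
    rw [← AddSubgroup.relIndex_comap, ← AddSubgroup.inf_relIndex_right, ← inf_assoc, hkerF]
  have hb' : (AddSubgroup.pi Set.univ fun t : T => inv.dualSelmerStructure
        ((W.baseChange K).torsionGaloisModule n) 𝓖 (Sum.inr (t : HeightOneSpectrum (𝓞 K)))).relIndex
        (((inv.dualSelmerStructure ((W.baseChange K).torsionGaloisModule n) 𝓕).selmerGroup ⊓
          (conjActDual W σ n N + AddMonoidHom.id _).ker).map locT') =
      ((inv.dualSelmerStructure ((W.baseChange K).torsionGaloisModule n) 𝓖).selmerGroup ⊓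
          (conjActDual W σ n N + AddMonoidHom.id _).ker).relIndex
        ((inv.dualSelmerStructure ((W.baseChange K).torsionGaloisModule n) 𝓕).selmerGroup ⊓
          (conjActDual W σ n N + AddMonoidHom.id _).ker) := by
    rw [← AddSubgroup.relIndex_comap, ← AddSubgroup.inf_relIndex_right, ← inf_assoc, hkerG]
  rw [← ha, ← hb']
  exact hcount

end Signed

end Summit.BirchSwinnertonDyer.Rank1Residual.JET.GlobalDuality

end
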